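import Mathlib
import HarnessLib
import Summits.Ventures.LatticeQCDFlow.Exactness.KickedProductTrajectory

/-!
# Kicked products with STEP-INDEXED kicks and drift lengths (the OMF2 / OMF4 words): the half-step trajectory and the one-trajectory bounds — step 1 of the OMF ergodicity roadmap (R1)

HONEST FRAMING: exact (Metropolis-corrected) sampling algorithms for lattice gauge theory;
figures of merit are autocorrelation/cost numbers at stated couplings and volumes; no
continuum-physics claim.

Venture `LatticeQCDFlow` (cell pub-lqcd), topic `Exactness`, FANOUT row 9 (eng-latcore, GEN-25; the engine's
`hmc.HMC(f, β, 'omf2' | 'omf4').trajectory(τ, nstep, tau_jitter)` on 4D `SU(N)` — a REAL engine path whose ergodicity is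
NOT typed: GEN-24 HANDOFF item (R1)).  NEW WORK of the cell over gen-18's `KickedProductTrajectory.lean` (`plfStep`,
`plfTraj`, `PLFBounds` — ONE kick map `G` and ONE drift length `δ`).  WHY: the OMF2 step
`K(λε) D(ε/2) K((1−2λ)ε) D(ε/2) K(λε)` (and OMF4 likewise) is, after splitting each interior kick in two equal halves, a
product of P-first factors whose MERGED consecutive kicks ALTERNATE (`(1−2λ)ε·F`, `2λε·F`, …) and whose drift lengths may
differ — so gen-18's discrete-Grönwall analysis must be re-run with a step-indexed merged kick `Gs : ℕ → 𝔸 → V` and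
step-indexed drift lengths `δs : ℕ → ℝ`.  Every estimate of gen-18 uses only UNIFORM bounds on the kicks (`b`, `K` on the
group) and on the drift lengths, so the port is line by line; this file is the first part (definitions + one trajectory);
the two-trajectory estimate (`KickedProductTwoPoint` twin), the `SU(N)` position law for the OMF words of
`SUNOmfJitteredHMC.lean` and the threshold packaging are the next files (HANDOFF.md GEN-25 «R1 ROADMAP»).  Mathlib only;
nothing is cited as a fact; no number is claimed.

## Content

* §1 `plfSeqTraj ex J Gs δs p k = (W_k, m_k)` — `W_0 = 1`, `m_0 = p + Gs 0 1`, `W_{k+1} = ex (δs k • J m_k) · W_k`,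
  `m_{k+1} = m_k + Gs (k+1) W_{k+1}`; **`plfTraj_eq_plfSeqTraj`** — gen-18's trajectory is the instance
  `Gs 0 = G`, `Gs (k+1) = 2 • G`, `δs ≡ δ`.
* §2 `PLFSeqBounds ex J Gs T C b K ρ η` — the standing hypotheses with EVERY merged kick bounded by `b` and `K`-Lipschitz on
  the group `T`; `PLFBounds.toSeq` (gen-18's hypotheses give them with `2b`, `2K`); one trajectory: `W_k ∈ T`,
  `‖m_k − p‖ ≤ (k+1) b`, `‖m_k‖ ≤ R + (k+1) b`, the drift arguments are `≤ θ := δ‖J‖(R + (n+1)b)` when `0 ≤ δs k ≤ δ`,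
  **`‖W_k − 1‖ ≤ 2kθC`** for `k ≤ n` when `θ ≤ ρ`.

NOT CLAIMED: the two-trajectory estimate, any position law, any kernel, anything about OMF beyond the algebra of the
word; floating point.
-/

noncomputable section

namespace Summit.Ventures.LatticeQCDFlow.Exactness

open Set NNReal

variable {𝔸 : Type*} [NormedRing 𝔸] [NormedAlgebra ℝ 𝔸]
variable {V : Type*} [NormedAddCommGroup V] [NormedSpace ℝ V]

/-! ## §1 The step-indexed half-step trajectory -/

section Defs

variable (ex : 𝔸 → 𝔸) (J : V →L[ℝ] 𝔸) (Gs : ℕ → 𝔸 → V) (δs : ℕ → ℝ)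

/-- **The kicked product with step-indexed merged kicks `Gs k` and drift lengths `δs k`, in half-step form** from
`(1, p)`: `W_0 = 1`, `m_0 = p + Gs 0 1`, `W_{k+1} = ex (δs k • J m_k) · W_k`, `m_{k+1} = m_k + Gs (k+1) W_{k+1}`. -/
def plfSeqTraj (p : V) : ℕ → 𝔸 × V
  | 0 => (1, p + Gs 0 1)
  | k + 1 => (ex (δs k • J (plfSeqTraj p k).2) * (plfSeqTraj p k).1,
      (plfSeqTraj p k).2 + Gs (k + 1) (ex (δs k • J (plfSeqTraj p k).2) * (plfSeqTraj p k).1))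

variable (p : V)

/-- The step at `0`. -/
@[simp] theorem plfSeqTraj_zero : plfSeqTraj ex J Gs δs p 0 = (1, p + Gs 0 1) := rfl

/-- The recursion, first component. -/
theorem plfSeqTraj_succ_fst (k : ℕ) :
    (plfSeqTraj ex J Gs δs p (k + 1)).1 = ex (δs k • J (plfSeqTraj ex J Gs δs p k).2) * (plfSeqTraj ex J Gs δs p k).1 :=
  rfl

/-- The recursion, second component. -/
theorem plfSeqTraj_succ_snd (k : ℕ) :
    (plfSeqTraj ex J Gs δs p (k + 1)).2 =
      (plfSeqTraj ex J Gs δs p k).2 + Gs (k + 1) (plfSeqTraj ex J Gs δs p (k + 1)).1 := rfl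

/-- **GEN-18'S LEAPFROG TRAJECTORY IS THE CONSTANT-STEP INSTANCE**: `plfTraj ex J G δ` is `plfSeqTraj` with `Gs 0 = G`,
`Gs (k+1) = 2 • G`, `δs ≡ δ`. -/
theorem plfTraj_eq_plfSeqTraj (G : 𝔸 → V) (δ : ℝ) (k : ℕ) :
    plfTraj ex J G δ p k =
      plfSeqTraj ex J (fun j => if j = 0 then G else fun W => (2 : ℝ) • G W) (fun _ => δ) p k := by
  induction k with
  | zero => simp [plfTraj, plfSeqTraj]
  | succ k ih =>
    rw [plfTraj, plfSeqTraj, ih]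
    simp

end Defs

omit [NormedAlgebra ℝ 𝔸] in
/-- `‖ex a − 1‖ ≤ 2‖a‖` on the ball of radius `ρ`, from `ex 0 = 1` and a Lipschitz defect `η ≤ 1` (structure-free form;
gen-18's `PLFBounds.norm_ex_sub_one_le` is the instance). -/
theorem norm_ex_sub_one_le_of_defect {ex : 𝔸 → 𝔸} {ρ η : ℝ} (h0 : ex 0 = 1)
    (hdef : ∀ a a' : 𝔸, ‖a‖ ≤ ρ → ‖a'‖ ≤ ρ → ‖ex a - ex a' - (a - a')‖ ≤ η * ‖a - a'‖) (hη1 : η ≤ 1) (hρ0 : 0 ≤ ρ)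
    {a : 𝔸} (ha : ‖a‖ ≤ ρ) : ‖ex a - 1‖ ≤ 2 * ‖a‖ := by
  have hd := hdef a 0 ha (by rw [norm_zero]; exact hρ0)
  rw [h0, sub_zero] at hd
  calc ‖ex a - 1‖ = ‖(ex a - 1 - a) + a‖ := by rw [sub_add_cancel]
    _ ≤ ‖ex a - 1 - a‖ + ‖a‖ := norm_add_le _ _
    _ ≤ η * ‖a‖ + ‖a‖ := add_le_add hd le_rfl
    _ ≤ 1 * ‖a‖ + ‖a‖ := by gcongr
    _ = 2 * ‖a‖ := by ring

/-! ## §2 Standing hypotheses with step-indexed kicks; one trajectory -/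

/-- **The standing hypotheses, step-indexed kicks.**  As gen-18's `PLFBounds`, but EVERY merged kick `Gs k` is bounded
by `b` and `K`-Lipschitz ON `T`. -/
structure PLFSeqBounds (ex : 𝔸 → 𝔸) (J : V →L[ℝ] 𝔸) (Gs : ℕ → 𝔸 → V) (T : Set 𝔸) (C b K ρ η : ℝ) : Prop where
  one_mem : (1 : 𝔸) ∈ T
  mul_mem : ∀ (v : V) (W : 𝔸), W ∈ T → ex (J v) * W ∈ T
  norm_le : ∀ W ∈ T, ‖W‖ ≤ C
  one_le : 1 ≤ C
  force_le : ∀ k, ∀ W ∈ T, ‖Gs k W‖ ≤ b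
  force_lip : ∀ k, ∀ W ∈ T, ∀ W' ∈ T, ‖Gs k W - Gs k W'‖ ≤ K * ‖W - W'‖
  lip_nonneg : 0 ≤ K
  ex_zero : ex 0 = 1
  ex_defect : ∀ a a' : 𝔸, ‖a‖ ≤ ρ → ‖a'‖ ≤ ρ → ‖ex a - ex a' - (a - a')‖ ≤ η * ‖a - a'‖
  defect_nonneg : 0 ≤ η
  defect_le_one : η ≤ 1
  radius_nonneg : 0 ≤ ρ

/-- **GEN-18'S HYPOTHESES GIVE THE STEP-INDEXED ONES** for the constant-step instance, with `2b` and `2K`. -/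
theorem PLFBounds.toSeq {ex : 𝔸 → 𝔸} {J : V →L[ℝ] 𝔸} {G : 𝔸 → V} {T : Set 𝔸} {C b K ρ η : ℝ}
    (h : PLFBounds ex J G T C b K ρ η) :
    PLFSeqBounds ex J (fun j => if j = 0 then G else fun W => (2 : ℝ) • G W) T C (2 * b) (2 * K) ρ η where
  one_mem := h.one_mem
  mul_mem := h.mul_mem
  norm_le := h.norm_le
  one_le := h.one_le
  force_le k W hW := by
    have hb := h.force_bound_nonneg
    by_cases hk : k = 0
    · simp only [hk, ↓reduceIte]
      linarith [h.force_le W hW]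
    · simp only [hk, ↓reduceIte, norm_smul, Real.norm_two]
      exact mul_le_mul_of_nonneg_left (h.force_le W hW) zero_le_two
  force_lip k W hW W' hW' := by
    by_cases hk : k = 0
    · simp only [hk, ↓reduceIte]
      have h1 := h.force_lip W hW W' hW'
      have h2 : 0 ≤ K * ‖W - W'‖ := mul_nonneg h.lip_nonneg (norm_nonneg _)
      linarith
    · simp only [hk, ↓reduceIte, ← smul_sub, norm_smul, Real.norm_two, mul_assoc]
      exact mul_le_mul_of_nonneg_left (h.force_lip W hW W' hW') zero_le_two
  lip_nonneg := by linarith [h.lip_nonneg]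
  ex_zero := h.ex_zero
  ex_defect := h.ex_defect
  defect_nonneg := h.defect_nonneg
  defect_le_one := h.defect_le_one
  radius_nonneg := h.radius_nonneg

section OneTrajectory

variable {ex : 𝔸 → 𝔸} {J : V →L[ℝ] 𝔸} {Gs : ℕ → 𝔸 → V} {T : Set 𝔸} {C b K ρ η : ℝ}
  (h : PLFSeqBounds ex J Gs T C b K ρ η) (δs : ℕ → ℝ) (p : V)
include h

/-- **`W_k ∈ T`** along the trajectory. -/
theorem plfSeqTraj_fst_mem (k : ℕ) : (plfSeqTraj ex J Gs δs p k).1 ∈ T := by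
  induction k with
  | zero => exact h.one_mem
  | succ k ih =>
    rw [plfSeqTraj_succ_fst, ← map_smul]
    exact h.mul_mem _ _ ih

/-- **`‖m_k − p‖ ≤ (k+1) b`.** -/
theorem plfSeqTraj_snd_sub_le (k : ℕ) : ‖(plfSeqTraj ex J Gs δs p k).2 - p‖ ≤ ((k : ℝ) + 1) * b := by
  induction k with
  | zero => simpa using h.force_le 0 1 h.one_mem
  | succ k ih =>
    rw [plfSeqTraj_succ_snd]
    have h2 : ‖Gs (k + 1) (plfSeqTraj ex J Gs δs p (k + 1)).1‖ ≤ b :=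
      h.force_le _ _ (plfSeqTraj_fst_mem h δs p (k + 1))
    calc ‖(plfSeqTraj ex J Gs δs p k).2 + Gs (k + 1) (plfSeqTraj ex J Gs δs p (k + 1)).1 - p‖
        = ‖((plfSeqTraj ex J Gs δs p k).2 - p) + Gs (k + 1) (plfSeqTraj ex J Gs δs p (k + 1)).1‖ := by abel_nf
      _ ≤ ‖(plfSeqTraj ex J Gs δs p k).2 - p‖ + ‖Gs (k + 1) (plfSeqTraj ex J Gs δs p (k + 1)).1‖ := norm_add_le _ _
      _ ≤ ((k : ℝ) + 1) * b + b := add_le_add ih h2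
      _ = ((↑(k + 1) : ℝ) + 1) * b := by push_cast; ring

/-- `‖m_k‖ ≤ R + (k+1) b` for `‖p‖ ≤ R`. -/
theorem norm_plfSeqTraj_snd_le {R : ℝ} (hp : ‖p‖ ≤ R) (k : ℕ) :
    ‖(plfSeqTraj ex J Gs δs p k).2‖ ≤ R + ((k : ℝ) + 1) * b := by
  calc ‖(plfSeqTraj ex J Gs δs p k).2‖ = ‖p + ((plfSeqTraj ex J Gs δs p k).2 - p)‖ := by rw [add_sub_cancel]
    _ ≤ ‖p‖ + ‖(plfSeqTraj ex J Gs δs p k).2 - p‖ := norm_add_le _ _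
    _ ≤ R + ((k : ℝ) + 1) * b := add_le_add hp (plfSeqTraj_snd_sub_le h δs p k)

/-- **The drift arguments are small**: for `0 ≤ δs k ≤ δ`, `‖p‖ ≤ R` and `k ≤ n`,
`‖δs k • J m_k‖ ≤ δ‖J‖(R + (n+1) b)` (`=: θ`). -/
theorem norm_seqDriftArg_le {R : ℝ} (hp : ‖p‖ ≤ R) {δ : ℝ} (hδ0 : ∀ k, 0 ≤ δs k) (hδ : ∀ k, δs k ≤ δ)
    {n k : ℕ} (hk : k ≤ n) :
    ‖δs k • J (plfSeqTraj ex J Gs δs p k).2‖ ≤ δ * ‖J‖ * (R + ((n : ℝ) + 1) * b) := by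
  have hb : 0 ≤ b := (norm_nonneg _).trans (h.force_le 0 1 h.one_mem)
  have hkn : (k : ℝ) ≤ n := Nat.cast_le.2 hk
  have hδ' : 0 ≤ δ := (hδ0 k).trans (hδ k)
  have hR : 0 ≤ R + ((n : ℝ) + 1) * b := by nlinarith [norm_nonneg p]
  rw [norm_smul, Real.norm_of_nonneg (hδ0 k), mul_assoc]
  have hm : ‖J (plfSeqTraj ex J Gs δs p k).2‖ ≤ ‖J‖ * (R + ((n : ℝ) + 1) * b) := by
    refine (J.le_opNorm _).trans (mul_le_mul_of_nonneg_left ?_ (norm_nonneg _))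
    refine (norm_plfSeqTraj_snd_le h δs p hp k).trans ?_
    nlinarith
  calc δs k * ‖J (plfSeqTraj ex J Gs δs p k).2‖ ≤ δs k * (‖J‖ * (R + ((n : ℝ) + 1) * b)) :=
        mul_le_mul_of_nonneg_left hm (hδ0 k)
    _ ≤ δ * (‖J‖ * (R + ((n : ℝ) + 1) * b)) :=
        mul_le_mul_of_nonneg_right (hδ k) (mul_nonneg (norm_nonneg _) hR)

/-- **`‖W_k − 1‖ ≤ 2kθC`** for `k ≤ n`, when the drift arguments are `≤ θ ≤ ρ` (`0 ≤ δs k ≤ δ`). -/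
theorem norm_plfSeqTraj_fst_sub_one_le {R : ℝ} (hp : ‖p‖ ≤ R) {δ : ℝ} (hδ0 : ∀ k, 0 ≤ δs k) (hδ : ∀ k, δs k ≤ δ)
    {n : ℕ} (hρ : δ * ‖J‖ * (R + ((n : ℝ) + 1) * b) ≤ ρ) :
    ∀ k ≤ n, ‖(plfSeqTraj ex J Gs δs p k).1 - 1‖ ≤ k * (2 * (δ * ‖J‖ * (R + ((n : ℝ) + 1) * b)) * C) := by
  intro k
  induction k with
  | zero => intro; simp
  | succ k ih =>
    intro hk
    have hkn : k ≤ n := Nat.le_of_succ_le hk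
    set θ : ℝ := δ * ‖J‖ * (R + ((n : ℝ) + 1) * b) with hθ
    set W := (plfSeqTraj ex J Gs δs p k).1 with hW
    set a := δs k • J (plfSeqTraj ex J Gs δs p k).2 with ha
    have haθ : ‖a‖ ≤ θ := norm_seqDriftArg_le h δs p hp hδ0 hδ hkn
    have hsplit : (plfSeqTraj ex J Gs δs p (k + 1)).1 - 1 = (ex a - 1) * W + (W - 1) := by
      rw [plfSeqTraj_succ_fst]; noncomm_ring
    rw [hsplit]
    calc ‖(ex a - 1) * W + (W - 1)‖ ≤ ‖ex a - 1‖ * ‖W‖ + ‖W - 1‖ :=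
          (norm_add_le _ _).trans (add_le_add (norm_mul_le _ _) le_rfl)
      _ ≤ 2 * θ * C + k * (2 * θ * C) := by
          refine add_le_add ?_ (ih hkn)
          have h1 : ‖ex a - 1‖ ≤ 2 * θ :=
            (norm_ex_sub_one_le_of_defect h.ex_zero h.ex_defect h.defect_le_one h.radius_nonneg (haθ.trans hρ)).trans
              (by linarith)
          exact mul_le_mul h1 (h.norm_le _ (plfSeqTraj_fst_mem h δs p k)) (norm_nonneg _)
            (by linarith [norm_nonneg a])
      _ = (↑(k + 1) : ℝ) * (2 * θ * C) := by push_cast; ring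

end OneTrajectory

end Summit.Ventures.LatticeQCDFlow.Exactness

end
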